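import Summits.QuantumFields.YangMills.Theorems.BalabanUVNodesN06Row17LocalClauseOnReg335Small
import Literature.MathematicalPhysics.QuantumFieldTheory.Balaban1983to89.B13LocalisationRemainderRoadCubeLetters

/-!
# BalabanUVNodes ∕ N06 ([B9], `Dag.B9_main`) — ROW 17 ON PRINT's CLASS (3.35) FROM THE CUBE LETTERS ALONE, «FOR Mα₀ SUFFICIENTLY SMALL»: dag-n10-w6's knit face
# `B13LocalisationRemainderRoadCubeLetters.deltaAY_parSymY_posDefTr_of_cubeLetters` with its per-cube local clause `hloc` DISCHARGED by
# `…N06Row17LocalClauseOnReg335Small.posDefTr_padDeltaALocY_of_regYP335_small`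

Track A of `YM-PLAN.md` (cell `pub-ymgap`, HUMAN RULING D-0062), node **N06** = [Balaban1985BackgroundPropagators] Thms 3.1–3.15; seat `pub-ymgap-dag-n06-j`
(bundle F5, rows 15–17), g28.  A HELPER (count-neutral, `--supports` only).

THE PRINT.  [B9] Thm 3.11 p. 416: *«Δ_a(U) … is positive definite … We use the localization (3.105)–(3.106) … G_□(e^{iηA}) is positive also for A sufficiently small,
i.e., for Mα₀ sufficiently small»*; (3.105)–(3.106) p. 414; (3.87)–(3.89) pp. 409–410; (3.35) p. 396.

WHAT.  dag-n10-w6 g5's `deltaAY_parSymY_posDefTr_of_cubeLetters` (p646800, «the knit statement of your row-17 road», bus 2026-08-28T16:06Z) gives the certificate's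
`PosDefTr 1 (Δ_a(U))` at def-Y's letters for a `G`-valued `U` from (i) a per-cube local clause `hloc : ∀ c, PosDefTr 1 (padDeltaALocY i parSymY parBY (Dc c) (cutMulY (χP c))
(cutMulY (χ c)) U)`, (ii) the LETTERS at `U` (row ∕ column sums `≤ g` of the local inverses `G_□(U) = GAsqY …`, `δ`-first moments `≤ κ` of `Δ_a(U)`, `|h_c|`-weighted sums
`≤ ε` of the defect `D_U(R_□(U) − R(U))D*_U`, slowness `ω` and overlap `n` of the partition `Σ_c h_c² = 1`) and (iii) `n·g·(2ωκ + ε) < 1`.  THIS FILE removes (i): by this seat's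
`posDefTr_padDeltaALocY_of_regYP335_small` (the end-to-end local-cube road at `U₀ = 1`, `B13DirichletLocalRoadPadLetters{Located,Exists}`) the clause holds at every cover
cube `□̃(c) = cubeDomY x c`, every block set `Dblk c` inside it and every 0∕1 bond cut issuing from it, for every `U ∈ Reg335 cthr α₀` with `α₀ ≤ α₁(x)`.
* ★★★ `deltaAY_parSymY_posDefTr_on_regYP335_of_cubeLetters_small` — for `G ≤ U(N)`, a member `x`, `2 ≤ d+1`, `0 < b₀`, `cthr ≤ 10`: **`∃ α₁ > 0` such that for every choice
  of block sets `Dblk c ⊆ □̃(c)`, partition `h` (`Σ_c h_c² = 1`) with 0∕1 majorants `χ_c ⊇ supp h_c` issuing from `□̃(c)`, every `0 ≤ α₀ ≤ α₁`, every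
  `U ∈ (bg9YP … G x).Reg335 cthr α₀`, and every letter datum `(δ, ω, κ, g, ε, n)` at `U` with `n·g·(2ωκ + ε) < 1`:
  `PosDefTr 1 (deltaAY x.toKIdx (parSymY _) (parBY _) (GpY _ (parSymY _)) U)`** — ROW 17 (`hΔA`) on print's class from the letters ALONE.
HONEST FRAMING.  A two-theorem composition; the LETTERS (ii) at `U` — print's Thms 3.1–3.3 ∕ (3.89) content for `Δ_a(U)`, `G_□(U)` and the defect — and the inequality (iii)
stay DISPLAYED; `α₁` is member-dependent (k-dependent located radius, dag-n10-w3 g5's LOCATED (c); print's class-uniform `α₁` = the (3.37)-scaled pencil, NOT this file);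
COUNT-NEUTRAL; N06 ∕ N10 NOT discharged; K1⁹ OPEN, no registered stub proved; nothing continuum ∕ OS ∕ mass gap ∕ Clay.  0 `def`, 0 `sorry`.
-/
noncomputable section

namespace Summit.QuantumFields.YangMills.BalabanUVNodes.N06Row17OnReg335OfCubeLettersSmall

open Finset
open Literature.MathematicalPhysics.QuantumFieldTheory.Balaban1983to89
open Literature.MathematicalPhysics.QuantumFieldTheory.Balaban1983to89.Node00
open Literature.MathematicalPhysics.QuantumFieldTheory.Balaban1983to89.Node00.OpsYLocalInverse (dirPadY dirInvY)
open Literature.MathematicalPhysics.QuantumFieldTheory.Balaban1983to89.Node00.OpsYDeltaALocal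
open Literature.MathematicalPhysics.QuantumFieldTheory.Balaban1983to89.B9Thm311ReadingCoords (PosDefTr)
open Literature.MathematicalPhysics.QuantumFieldTheory.Balaban1983to89.B9Thm37CubeCoverCommutators (cutMulY)
open Literature.MathematicalPhysics.QuantumFieldTheory.Balaban1983to89.B9Thm39CubeOpsAtLettersY (blkIndY)
open Literature.MathematicalPhysics.QuantumFieldTheory.Balaban1983to89.B6KLevelCensusIndexV1 (KIdx kGeo)
open Literature.MathematicalPhysics.QuantumFieldTheory.Balaban1983to89.B6GlobalChartV1 (PV boxEquiv)
open Literature.MathematicalPhysics.QuantumFieldTheory.Balaban1983to89.B9BackgroundsKLevelV1 (CfgV1)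
open Literature.MathematicalPhysics.QuantumFieldTheory.Balaban1983to89.B9BackgroundsKLevelV1P (bg9YP mem_of_reg335P)
open Literature.MathematicalPhysics.QuantumFieldTheory.Balaban1983to89.B9PinMembersKLevelV1 (MemberY)
open Literature.MathematicalPhysics.QuantumFieldTheory.Balaban1983to89.B6Cover236MultiLevelBlocks (cubes)
open Literature.MathematicalPhysics.QuantumFieldTheory.Balaban1983to89.B9WalkLettersCoordsS (cubeDomY)
open Literature.MathematicalPhysics.QuantumFieldTheory.Balaban1983to89.B6Geom246MultiLevelBox (blkOf)
open Literature.MathematicalPhysics.QuantumFieldTheory.Balaban1983to89.B13LocalisationRemainderRoadCubeLetters (deltaAY_parSymY_posDefTr_of_cubeLetters)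
open Summit.QuantumFields.YangMills.BalabanUVNodes.N06Row17LocalClauseOnReg335Small (posDefTr_padDeltaALocY_of_regYP335_small)
open scoped Matrix
open scoped Matrix.Norms.L2Operator

variable {N : ℕ} [NeZero N] {d ℓ : ℕ} {hd : 1 ≤ d + 1} {hL : Odd (ℓ + 1) ∧ 1 < ℓ + 1} {b₀ b₁ : ℝ} {Mstar : ℕ}

/-- ★★★ **ROW 17 ON (3.35) FROM THE CUBE LETTERS ALONE, FOR `Mα₀` SUFFICIENTLY SMALL.**  For `G ≤ U(N)`, a member `x`, `2 ≤ d + 1`, `0 < b₀`, `cthr ≤ 10` there is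
**`α₁ > 0`** such that: for every choice of block sets `Dblk c` inside the enlarged cubes `□̃(c) = cubeDomY x c`, every partition `h` with `Σ_c h_c(b)² = 1`, 0∕1 majorants
`χ_c` (`supp h_c ⊆ {χ_c = 1}`) issuing from `□̃(c)`, every `0 ≤ α₀ ≤ α₁`, every `U ∈ (bg9YP … G x).Reg335 cthr α₀`, every entry distance `δ ≥ 0` and letters `ω, κ, g, ε ≥ 0`,
`n` at `U` (Lipschitz `|h_c(p) − h_c(s)| ≤ ωδ(p,s)`, overlap `≤ n`, row ∕ column sums of the local inverses `G_□(U)` `≤ g`, `δ`-moments of `Δ_a(U)` `≤ κ`, `|h_c|`-weighted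
sums of `D_U(R_□(U) − R(U))D*_U` `≤ ε`) with `n·g·(2ωκ + ε) < 1`: **`PosDefTr 1 (deltaAY x.toKIdx (parSymY _) (parBY _) (GpY _ (parSymY _)) U)`** — dag-n10-w6's
`deltaAY_parSymY_posDefTr_of_cubeLetters` with `hloc` supplied by `posDefTr_padDeltaALocY_of_regYP335_small` (`U` is `G`-valued by `mem_of_reg335P`).
[cite: Balaban1985BackgroundPropagators, Thm 3.11 p.416, (3.105)–(3.106) p.414, Sect. C pp.408–409, (3.87)–(3.89) pp.409–410, (3.35) p.396, Cor. 3.6 p.408;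
Balaban1984PropagatorsII, Lemma 2.1 (2.61) p.234, p.235, p.238 (T_□), Lemma 2.4 (2.128) p.245; Balaban1988RG2Cluster, (2.5)–(2.7) pp.12–13, p.15] -/
theorem deltaAY_parSymY_posDefTr_on_regYP335_of_cubeLetters_small {G : Subgroup (Matrix (Fin N) (Fin N) ℂ)ˣ}
    (hG : G ≤ B7Prop2Explicit.unitaryUnits (Matrix (Fin N) (Fin N) ℂ)) (x : MemberY d ℓ hd hL b₀ b₁ Mstar) (hd2 : 2 ≤ d + 1) (hb₀ : 0 < b₀)
    {cthr : ℝ} (hc : cthr ≤ 10) :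
    ∃ α₁ : ℝ, 0 < α₁ ∧
      ∀ (Dblk : ↥(cubes x.toKIdx.D.toDomains) → Finset (BlkY x.toKIdx)),
        (∀ (c : ↥(cubes x.toKIdx.D.toDomains)) (z : SiteY x.toKIdx), blkOf x.toKIdx.D.toDomains z ∈ Dblk c → z ∈ cubeDomY x c) →
      ∀ (hf : ↥(cubes x.toKIdx.D.toDomains) → FBondY x.toKIdx → ℝ), (∀ b, ∑ c, hf c b ^ 2 = 1) →
      ∀ (χ : ↥(cubes x.toKIdx.D.toDomains) → FBondY x.toKIdx → ℝ), (∀ c b, χ c b = 0 ∨ χ c b = 1) → (∀ c b, hf c b ≠ 0 → χ c b = 1) →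
        (∀ c b, χ c b ≠ 0 → boxEquiv x.toKIdx.hN b.src ∈ cubeDomY x c) →
      ∀ α₀ : ℝ, 0 ≤ α₀ → α₀ ≤ α₁ → ∀ U : CfgV1 (PV d ℓ x.m x.K hd hL) (Matrix (Fin N) (Fin N) ℂ),
        (bg9YP (Matrix (Fin N) (Fin N) ℂ) G x).Reg335 cthr α₀ U →
      ∀ (δ : FBondY x.toKIdx × (Fin N × Fin N) → FBondY x.toKIdx × (Fin N × Fin N) → ℝ) (ω κ g ε : ℝ) (n : ℕ),
        0 ≤ ω → (∀ p s, 0 ≤ δ p s) → 0 ≤ g → 0 ≤ ε →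
        (∀ c p s, |hf c p.1 - hf c s.1| ≤ ω * δ p s) → (∀ b : FBondY x.toKIdx, (univ.filter fun c => hf c b ≠ 0).card ≤ n) →
        (∀ c s, ∑ r, ‖LinearMap.toMatrix ((Pi.basis fun _ : FBondY x.toKIdx => Matrix.stdBasis ℂ (Fin N) (Fin N)).reindex
              (Equiv.sigmaEquivProd (FBondY x.toKIdx) (Fin N × Fin N)))
            ((Pi.basis fun _ : FBondY x.toKIdx => Matrix.stdBasis ℂ (Fin N) (Fin N)).reindex (Equiv.sigmaEquivProd (FBondY x.toKIdx) (Fin N × Fin N)))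
            (GAsqY x.toKIdx (parSymY x.toKIdx) (parBY x.toKIdx) (cubeDomY x c) (cutMulY (blkIndY x.toKIdx (Dblk c))) (cutMulY (χ c)) U) s r‖ ≤ g) →
        (∀ c r, ∑ s, ‖LinearMap.toMatrix ((Pi.basis fun _ : FBondY x.toKIdx => Matrix.stdBasis ℂ (Fin N) (Fin N)).reindex
              (Equiv.sigmaEquivProd (FBondY x.toKIdx) (Fin N × Fin N)))
            ((Pi.basis fun _ : FBondY x.toKIdx => Matrix.stdBasis ℂ (Fin N) (Fin N)).reindex (Equiv.sigmaEquivProd (FBondY x.toKIdx) (Fin N × Fin N)))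
            (GAsqY x.toKIdx (parSymY x.toKIdx) (parBY x.toKIdx) (cubeDomY x c) (cutMulY (blkIndY x.toKIdx (Dblk c))) (cutMulY (χ c)) U) s r‖ ≤ g) →
        (∀ p, ∑ s, ‖LinearMap.toMatrix ((Pi.basis fun _ : FBondY x.toKIdx => Matrix.stdBasis ℂ (Fin N) (Fin N)).reindex
              (Equiv.sigmaEquivProd (FBondY x.toKIdx) (Fin N × Fin N)))
            ((Pi.basis fun _ : FBondY x.toKIdx => Matrix.stdBasis ℂ (Fin N) (Fin N)).reindex (Equiv.sigmaEquivProd (FBondY x.toKIdx) (Fin N × Fin N)))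
            (deltaAY x.toKIdx (parSymY x.toKIdx) (parBY x.toKIdx) (GpY x.toKIdx (parSymY x.toKIdx)) U) p s‖ * δ p s ≤ κ) →
        (∀ s, ∑ p, ‖LinearMap.toMatrix ((Pi.basis fun _ : FBondY x.toKIdx => Matrix.stdBasis ℂ (Fin N) (Fin N)).reindex
              (Equiv.sigmaEquivProd (FBondY x.toKIdx) (Fin N × Fin N)))
            ((Pi.basis fun _ : FBondY x.toKIdx => Matrix.stdBasis ℂ (Fin N) (Fin N)).reindex (Equiv.sigmaEquivProd (FBondY x.toKIdx) (Fin N × Fin N)))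
            (deltaAY x.toKIdx (parSymY x.toKIdx) (parBY x.toKIdx) (GpY x.toKIdx (parSymY x.toKIdx)) U) p s‖ * δ p s ≤ κ) →
        (∀ c p, |hf c p.1| * ∑ s, ‖LinearMap.toMatrix ((Pi.basis fun _ : FBondY x.toKIdx => Matrix.stdBasis ℂ (Fin N) (Fin N)).reindex
              (Equiv.sigmaEquivProd (FBondY x.toKIdx) (Fin N × Fin N)))
            ((Pi.basis fun _ : FBondY x.toKIdx => Matrix.stdBasis ℂ (Fin N) (Fin N)).reindex (Equiv.sigmaEquivProd (FBondY x.toKIdx) (Fin N × Fin N)))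
            (gradY x.toKIdx U ∘ₗ (RlocY x.toKIdx (parSymY x.toKIdx) (cubeDomY x c) (cutMulY (blkIndY x.toKIdx (Dblk c))) U -
              RY x.toKIdx (parSymY x.toKIdx) (GpY x.toKIdx (parSymY x.toKIdx)) U) ∘ₗ divY x.toKIdx U) p s‖ ≤ ε) →
        (∀ c s, ∑ p, |hf c p.1| * ‖LinearMap.toMatrix ((Pi.basis fun _ : FBondY x.toKIdx => Matrix.stdBasis ℂ (Fin N) (Fin N)).reindex
              (Equiv.sigmaEquivProd (FBondY x.toKIdx) (Fin N × Fin N)))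
            ((Pi.basis fun _ : FBondY x.toKIdx => Matrix.stdBasis ℂ (Fin N) (Fin N)).reindex (Equiv.sigmaEquivProd (FBondY x.toKIdx) (Fin N × Fin N)))
            (gradY x.toKIdx U ∘ₗ (RlocY x.toKIdx (parSymY x.toKIdx) (cubeDomY x c) (cutMulY (blkIndY x.toKIdx (Dblk c))) U -
              RY x.toKIdx (parSymY x.toKIdx) (GpY x.toKIdx (parSymY x.toKIdx)) U) ∘ₗ divY x.toKIdx U) p s‖ ≤ ε) →
        (n : ℝ) * g * (2 * ω * κ + ε) < 1 →
        PosDefTr (fun _ => (1 : ℝ)) (deltaAY x.toKIdx (parSymY x.toKIdx) (parBY x.toKIdx) (GpY x.toKIdx (parSymY x.toKIdx)) U) := by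
  obtain ⟨α₁, hα₁, hloc⟩ := posDefTr_padDeltaALocY_of_regYP335_small hG x hd2 hb₀ hc
  refine ⟨α₁, hα₁, ?_⟩
  intro Dblk hDD hf hsq χ hχ hsupp hχD α₀ hα₀ hαle U hreg δ ω κ g ε n hω hδ hg hε hlip hov hGrow hGcol hTrow hTcol hErow hEcol hθ
  exact deltaAY_parSymY_posDefTr_of_cubeLetters x.toKIdx hG (mem_of_reg335P x.toKIdx hreg.1) (fun c => cubeDomY x c)
    (fun c => blkIndY x.toKIdx (Dblk c)) hf hsq χ hχ hsupp
    (fun c => hloc c (Dblk c) (hDD c) (χ c) (hχ c) (hχD c) α₀ hα₀ hαle U hreg) δ hω hδ hg hε hlip hov hGrow hGcol hTrow hTcol hErow hEcol hθ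

end Summit.QuantumFields.YangMills.BalabanUVNodes.N06Row17OnReg335OfCubeLettersSmall

end
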